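import Literature.MathematicalPhysics.QuantumLattice.TorusEuclidLogDipole
import Literature.MathematicalPhysics.QuantumLattice.TorusDiagOutwardNeighbours
import Mathlib.Analysis.SpecialFunctions.Trigonometric.DerivHyp
import HarnessLib

/-!
# The Euclidean logarithmic dipole on the diagonal bond graph of `(ℤ/Lℤ)²`

Trunk T-QLATTICE (family `hubbard`; consumer: the sharp Koma–Tasaki `η`-line of the `t–t'`
Hubbard model, `Summits/HubbardSuperconductivity/HubbardLadder/Bounds/`).

Koma–Tasaki (PRL 68 (1992) 3248, note 9) record that their bound (13) covers any finite-range
hopping: in the complex-gauge estimate each bond family enters with its own hopping amplitude,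
`|⟨…⟩| ≤ e^{-2(φ_x-φ_y)} exp[β(|t| E_{n.n.}(φ) + |t'| E_{diag}(φ))]`,
`E_G(φ) = Σ_u Σ_v [u ∼_G v] (cosh(φ_u - φ_v) - 1)` (`HubbardGaugeBoundTTPrime.lean`). This file
computes the DIAGONAL energy of the explicit Euclidean truncated logarithmic monopole
`u ↦ q g_{ρ²}(|u|₂²)` of `TorusEuclidLogDipole.lean` with the sharp constant:
* `euclidLogMonopole_diagEnergy_le` —
  `E_{diag} ≤ 4π q² H(ρ) + 289 q² + 3402 q⁴ e^{2q²}` for `q ≥ 0`, uniformly in `L`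
  (a diagonal bond vector has `|e₁ ± e₂|₂² = 2`, so the quadratic form `(q²/2) Σ_{bonds}|∇φ|²`
  of `φ = q log|u|₂` is `2 q² Σ_u |u|₂⁻² ≈ 4π q² log ρ` in the double sum, twice the
  nearest-neighbour value `2π q² log ρ`). At the site with cyclic coordinates `(a,b)`,
  `n = a² + b²`, the four diagonal bonds change `|·|₂²` by `α_σ + β_τ` with
  `{α₊, α₋} = {2a+1, -(2a-1)}` away from the axes (one coordinate goes up, the other goes DOWN —
  `cyclicAbs_types`), and `Σ_{σ,τ} (α_σ + β_τ)₊² ≤ 8n + 16(a+b) + 12` (`four_bond_sum_le`: the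
  cross terms `±2ab` of the up–up and the mixed bonds cancel, which is what makes `4π` sharp);
* `exists_euclidLogDipole_two_graphs` — the dipole of `TorusEuclidLogDipole.exists_euclidLogDipole`
  (gain `2q log ρ`) with BOTH its nearest-neighbour energy `≤ 2(2π q² H(ρ) + 76 q² + 544 q⁴ e^{2q²})`
  and its diagonal energy `≤ 2(4π q² H(ρ) + 289 q² + 3402 q⁴ e^{2q²})`.
With `H(ρ) ≤ 1 + log ρ` the Koma–Tasaki exponent for the `t–t'` model becomes
`4q - 4π β(|t| + 2|t'|) q²`, maximal `1/(π β(|t| + 2|t'|))` at `q = 1/(2π β(|t|+2|t'|))`: the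
sharp `η = 1/4` line `T = (π/4)(|t| + 2|t'|)` of the class.

Sources: T. Koma, H. Tasaki, PRL 68 (1992) 3248, proof of eq. (13) (P1–P2) and note 9;
O. A. McBryan, T. Spencer, Commun. Math. Phys. 53 (1977) 299.

## Mathlib search
`Real.cosh_le_cosh`, `Real.cosh_le_exp_half_sq`, `Real.add_one_le_exp`,
`Real.log_le_sub_one_of_pos`, `Finset.sum_ite_eq'`, `Finset.sum_comm`, `Finset.sum_product`,
`Finset.sum_mul_sum`, `Fin.sum_univ_two`; tree: `torusDiagGraph_adj_iff`,
`torusDiagGraph_adj_sub_right_iff`, `torusDiagJump_apply_zero`, `torusDiagJump_apply_one`,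
`torusDist_le_one_of_diagAdj`, `min_val_add_one_le`, `card_filter_cyclicAbs_eq_le`,
`sum_sum_inv_normSq_le`, `sum_sum_secondary_le`, `euclidLogMonopole_energy_le`.
-/

noncomputable section

namespace Literature.MathematicalPhysics.QuantumLattice

open Finset Literature.Probability.LatticeModels

variable {L : ℕ} [NeZero L]

/-! ### Cyclic coordinates along a diagonal bond -/

/-- The cyclic absolute value `|v| = min(k, L - k)` of the representative `k` of `v ∈ ℤ/Lℤ`
(plumbing abbreviation). [folklore] -/
private def cabs (v : ZMod L) : ℕ := min v.val (L - v.val)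

omit [NeZero L] in
/-- `|z|₂² = |z₀|² + |z₁|²`. [folklore] -/
private theorem torusNormSq_eq_cabs (z : TorusSite 2 L) :
    torusNormSq z = cabs (z 0) ^ 2 + cabs (z 1) ^ 2 := rfl

/-- The representative of `a + 1`. [folklore] -/
private theorem val_add_one_casesD (a : ZMod L) :
    ((a + 1).val = a.val + 1 ∧ a.val + 1 < L) ∨ ((a + 1).val = 0 ∧ a.val + 1 = L) := by
  have ha : a.val < L := ZMod.val_lt a
  rcases Nat.lt_or_ge 1 L with hL | hL
  · have h1 : (1 : ZMod L).val = 1 := by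
      rw [ZMod.val_one_eq_one_mod, Nat.mod_eq_of_lt hL]
    have hv : (a + 1).val = (a.val + 1) % L := by rw [ZMod.val_add, h1]
    rcases Nat.lt_or_ge (a.val + 1) L with hlt | hge
    · left
      rw [hv, Nat.mod_eq_of_lt hlt]
      exact ⟨rfl, hlt⟩
    · right
      have hEq : a.val + 1 = L := le_antisymm ha hge
      rw [hv, hEq, Nat.mod_self]
      exact ⟨rfl, rfl⟩
  · have hL1 : L = 1 := le_antisymm hL (Nat.one_le_iff_ne_zero.mpr (NeZero.ne L))
    have hb : (a + 1).val < L := ZMod.val_lt _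
    right
    omega

/-- Along `v ↦ v ± 1` the cyclic absolute value changes by at most one. [folklore] -/
private theorem cabs_add_one_le (v : ZMod L) : cabs (v + 1) ≤ cabs v + 1 ∧ cabs (v - 1) ≤ cabs v + 1 := by
  have h1 := min_val_add_one_le L v
  have h2 := min_val_add_one_le L (v - 1)
  simp only [sub_add_cancel] at h2
  exact ⟨h1.1, h2.2⟩

/-- **The three types of a coordinate.** For `v ∈ ℤ/Lℤ` with `c = |v|`, `c₊ = |v+1|`,
`c₋ = |v-1|`: away from the axis (`c ≥ 1`) either exactly one neighbour goes up and then the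
other goes DOWN (`{c₊, c₋} = {c+1, c-1}`), or neither goes up (antipodal residues); on the axis
(`c = 0`) both are `≤ 1`. [folklore] -/
private theorem cyclicAbs_types (v : ZMod L) :
    (1 ≤ cabs v ∧ cabs (v + 1) = cabs v + 1 ∧ cabs (v - 1) + 1 = cabs v) ∨
    (1 ≤ cabs v ∧ cabs (v - 1) = cabs v + 1 ∧ cabs (v + 1) + 1 = cabs v) ∨
    (1 ≤ cabs v ∧ cabs (v + 1) ≤ cabs v ∧ cabs (v - 1) ≤ cabs v) ∨
    (cabs v = 0 ∧ cabs (v + 1) ≤ 1 ∧ cabs (v - 1) ≤ 1) := by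
  have h1 := val_add_one_casesD (v - 1)
  have h2 := val_add_one_casesD v
  simp only [sub_add_cancel] at h1
  have hv := ZMod.val_lt v
  have hm := ZMod.val_lt (v - 1)
  have hp := ZMod.val_lt (v + 1)
  unfold cabs
  omega

/-- The normalised type of a coordinate in terms of `α± = |v±1|² - |v|² ∈ ℤ` (up to the swap
`α₊ ↔ α₋`): UP–DOWN (`α₊ = 2A+1`, `α₋ = 1-2A`, `A ≥ 1`), NO-UP (`α± ≤ 0`, `A ≥ 1`), or AXIS
(`A = 0`, `α± ≤ 1`). [folklore] -/
private def CoordCore (A : ℕ) (αp αm : ℤ) : Prop :=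
  (1 ≤ A ∧ αp = 2 * A + 1 ∧ αm = 1 - 2 * A) ∨ (1 ≤ A ∧ αp ≤ 0 ∧ αm ≤ 0) ∨
    (A = 0 ∧ αp ≤ 1 ∧ αm ≤ 1)

/-- Every coordinate is of one of the three normalised types, up to the swap. [folklore] -/
private theorem coordCore_of_cyclicAbs (v : ZMod L) :
    CoordCore (cabs v) ((cabs (v + 1) : ℤ) ^ 2 - (cabs v : ℤ) ^ 2)
        ((cabs (v - 1) : ℤ) ^ 2 - (cabs v : ℤ) ^ 2) ∨
      CoordCore (cabs v) ((cabs (v - 1) : ℤ) ^ 2 - (cabs v : ℤ) ^ 2)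
        ((cabs (v + 1) : ℤ) ^ 2 - (cabs v : ℤ) ^ 2) := by
  have hc0 : (0 : ℤ) ≤ cabs v := Int.natCast_nonneg _
  have hp0 : (0 : ℤ) ≤ cabs (v + 1) := Int.natCast_nonneg _
  have hm0 : (0 : ℤ) ≤ cabs (v - 1) := Int.natCast_nonneg _
  rcases cyclicAbs_types v with ⟨h1, hp, hm⟩ | ⟨h1, hm, hp⟩ | ⟨h1, hp, hm⟩ | ⟨h0, hp, hm⟩
  · left; left
    refine ⟨h1, ?_, ?_⟩
    · have e : (cabs (v + 1) : ℤ) = cabs v + 1 := by exact_mod_cast hp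
      rw [e]; ring
    · have e : (cabs (v - 1) : ℤ) = cabs v - 1 := by omega
      rw [e]; ring
  · right; left
    refine ⟨h1, ?_, ?_⟩
    · have e : (cabs (v - 1) : ℤ) = cabs v + 1 := by exact_mod_cast hm
      rw [e]; ring
    · have e : (cabs (v + 1) : ℤ) = cabs v - 1 := by omega
      rw [e]; ring
  · left; right; left
    have ep : (cabs (v + 1) : ℤ) ≤ cabs v := by exact_mod_cast hp
    have em : (cabs (v - 1) : ℤ) ≤ cabs v := by exact_mod_cast hm
    exact ⟨h1, by nlinarith, by nlinarith⟩
  · left; right; right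
    have ep : (cabs (v + 1) : ℤ) ≤ 1 := by exact_mod_cast hp
    have em : (cabs (v - 1) : ℤ) ≤ 1 := by exact_mod_cast hm
    refine ⟨h0, ?_, ?_⟩
    · rw [h0]; push_cast; nlinarith
    · rw [h0]; push_cast; nlinarith

/-! ### The four diagonal bonds at a site: the integer inequality -/

/-- `x ≤ y`, `0 ≤ y` ⇒ `x₊² ≤ y²`. [folklore] -/
private theorem possq_le_sq {x y : ℤ} (h : x ≤ y) (hy : 0 ≤ y) : max x 0 ^ 2 ≤ y ^ 2 := by
  have h1 : max x 0 ≤ y := max_le h hy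
  have h0 : 0 ≤ max x 0 := le_max_right _ _
  nlinarith

/-- `x ≤ 0` ⇒ `x₊² = 0`. [folklore] -/
private theorem possq_eq_zero {x : ℤ} (h : x ≤ 0) : max x 0 ^ 2 = 0 := by
  rw [max_eq_right h]; norm_num

/-- **The four-bond inequality** (normalised orientations). With `n = A² + B²`,
`Σ_{σ,τ=±} (α_σ + β_τ)₊² ≤ 8n + 16(A+B) + 12`: in the UP–DOWN × UP–DOWN case the bonds are
`(2A+2B+2, 2A+2-2B, 2B+2-2A, ≤ 0)` and the cross terms `±8AB` cancel. [folklore] -/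
private theorem four_bond_core (A B : ℕ) (αp αm βp βm : ℤ) (hAB : ¬ (A = 0 ∧ B = 0))
    (hA : CoordCore A αp αm) (hB : CoordCore B βp βm) :
    max (αp + βp) 0 ^ 2 + max (αp + βm) 0 ^ 2 + max (αm + βp) 0 ^ 2 + max (αm + βm) 0 ^ 2 ≤
      8 * ((A : ℤ) ^ 2 + (B : ℤ) ^ 2) + 16 * ((A : ℤ) + B) + 12 := by
  have hA0 : (0 : ℤ) ≤ A := Int.natCast_nonneg A
  have hB0 : (0 : ℤ) ≤ B := Int.natCast_nonneg B
  have hnn : ∀ x : ℤ, 0 ≤ max x 0 ^ 2 := fun x => sq_nonneg _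
  simp only [CoordCore] at hA hB
  rcases hA with ⟨hA1, rfl, rfl⟩ | ⟨hA1, hap, ham⟩ | ⟨hAz, hap, ham⟩ <;>
    rcases hB with ⟨hB1, rfl, rfl⟩ | ⟨hB1, hbp, hbm⟩ | ⟨hBz, hbp, hbm⟩
  · -- UP–DOWN × UP–DOWN
    have hA1' : (1 : ℤ) ≤ A := by exact_mod_cast hA1
    have hB1' : (1 : ℤ) ≤ B := by exact_mod_cast hB1
    rw [max_eq_left (by linarith : (0 : ℤ) ≤ 2 * A + 1 + (2 * B + 1)),
      possq_eq_zero (by linarith : 1 - 2 * (A : ℤ) + (1 - 2 * B) ≤ 0)]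
    rcases lt_trichotomy (A : ℤ) B with hlt | heq | hgt
    · have hle : (A : ℤ) + 1 ≤ B := by omega
      rw [possq_eq_zero (by linarith : 2 * (A : ℤ) + 1 + (1 - 2 * B) ≤ 0),
        max_eq_left (by linarith : (0 : ℤ) ≤ 1 - 2 * A + (2 * B + 1))]
      nlinarith
    · rw [heq]
      have e1 : 2 * (B : ℤ) + 1 + (1 - 2 * B) = 2 := by ring
      have e2 : 1 - 2 * (B : ℤ) + (2 * B + 1) = 2 := by ring
      rw [e1, e2, max_eq_left (by norm_num : (0 : ℤ) ≤ 2)]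
      nlinarith
    · have hle : (B : ℤ) + 1 ≤ A := by omega
      rw [possq_eq_zero (by linarith : 1 - 2 * (A : ℤ) + (2 * B + 1) ≤ 0),
        max_eq_left (by linarith : (0 : ℤ) ≤ 2 * A + 1 + (1 - 2 * B))]
      nlinarith
  · -- UP–DOWN × NO-UP
    have hA1' : (1 : ℤ) ≤ A := by exact_mod_cast hA1
    have h1 := possq_le_sq (show 2 * (A : ℤ) + 1 + βp ≤ 2 * A + 1 by linarith) (by linarith)
    have h2 := possq_le_sq (show 2 * (A : ℤ) + 1 + βm ≤ 2 * A + 1 by linarith) (by linarith)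
    rw [possq_eq_zero (by linarith : 1 - 2 * (A : ℤ) + βp ≤ 0),
      possq_eq_zero (by linarith : 1 - 2 * (A : ℤ) + βm ≤ 0)]
    nlinarith
  · -- UP–DOWN × AXIS
    subst hBz
    have hA1' : (1 : ℤ) ≤ A := by exact_mod_cast hA1
    have h1 := possq_le_sq (show 2 * (A : ℤ) + 1 + βp ≤ 2 * A + 2 by linarith) (by linarith)
    have h2 := possq_le_sq (show 2 * (A : ℤ) + 1 + βm ≤ 2 * A + 2 by linarith) (by linarith)
    rw [possq_eq_zero (by linarith : 1 - 2 * (A : ℤ) + βp ≤ 0),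
      possq_eq_zero (by linarith : 1 - 2 * (A : ℤ) + βm ≤ 0)]
    push_cast
    nlinarith
  · -- NO-UP × UP–DOWN
    have hB1' : (1 : ℤ) ≤ B := by exact_mod_cast hB1
    have h1 := possq_le_sq (show αp + (2 * (B : ℤ) + 1) ≤ 2 * B + 1 by linarith) (by linarith)
    have h3 := possq_le_sq (show αm + (2 * (B : ℤ) + 1) ≤ 2 * B + 1 by linarith) (by linarith)
    rw [possq_eq_zero (by linarith : αp + (1 - 2 * (B : ℤ)) ≤ 0),
      possq_eq_zero (by linarith : αm + (1 - 2 * (B : ℤ)) ≤ 0)]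
    nlinarith
  · -- NO-UP × NO-UP
    rw [possq_eq_zero (by linarith : αp + βp ≤ 0), possq_eq_zero (by linarith : αp + βm ≤ 0),
      possq_eq_zero (by linarith : αm + βp ≤ 0), possq_eq_zero (by linarith : αm + βm ≤ 0)]
    nlinarith
  · -- NO-UP × AXIS
    subst hBz
    have hA1' : (1 : ℤ) ≤ A := by exact_mod_cast hA1
    have h1 := possq_le_sq (show αp + βp ≤ 1 by linarith) zero_le_one
    have h2 := possq_le_sq (show αp + βm ≤ 1 by linarith) zero_le_one
    have h3 := possq_le_sq (show αm + βp ≤ 1 by linarith) zero_le_one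
    have h4 := possq_le_sq (show αm + βm ≤ 1 by linarith) zero_le_one
    push_cast
    nlinarith
  · -- AXIS × UP–DOWN
    subst hAz
    have hB1' : (1 : ℤ) ≤ B := by exact_mod_cast hB1
    have h1 := possq_le_sq (show αp + (2 * (B : ℤ) + 1) ≤ 2 * B + 2 by linarith) (by linarith)
    have h3 := possq_le_sq (show αm + (2 * (B : ℤ) + 1) ≤ 2 * B + 2 by linarith) (by linarith)
    rw [possq_eq_zero (by linarith : αp + (1 - 2 * (B : ℤ)) ≤ 0),
      possq_eq_zero (by linarith : αm + (1 - 2 * (B : ℤ)) ≤ 0)]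
    push_cast
    nlinarith
  · -- AXIS × NO-UP
    subst hAz
    have hB1' : (1 : ℤ) ≤ B := by exact_mod_cast hB1
    have h1 := possq_le_sq (show αp + βp ≤ 1 by linarith) zero_le_one
    have h2 := possq_le_sq (show αp + βm ≤ 1 by linarith) zero_le_one
    have h3 := possq_le_sq (show αm + βp ≤ 1 by linarith) zero_le_one
    have h4 := possq_le_sq (show αm + βm ≤ 1 by linarith) zero_le_one
    push_cast
    nlinarith
  · -- AXIS × AXIS: excluded
    exact absurd ⟨hAz, hBz⟩ hAB

/-- **The four-bond inequality**, any orientations: for cyclic coordinates `(A, B) ≠ (0, 0)` and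
`α± = |z₀±1|² - A²`, `β± = |z₁±1|² - B²`,
`Σ_{σ,τ=±} (α_σ + β_τ)₊² ≤ 8(A²+B²) + 16(A+B) + 12`. [folklore] -/
private theorem four_bond_sum_le (A B : ℕ) (αp αm βp βm : ℤ) (hAB : ¬ (A = 0 ∧ B = 0))
    (hA : CoordCore A αp αm ∨ CoordCore A αm αp) (hB : CoordCore B βp βm ∨ CoordCore B βm βp) :
    max (αp + βp) 0 ^ 2 + max (αp + βm) 0 ^ 2 + max (αm + βp) 0 ^ 2 + max (αm + βm) 0 ^ 2 ≤
      8 * ((A : ℤ) ^ 2 + (B : ℤ) ^ 2) + 16 * ((A : ℤ) + B) + 12 := by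
  rcases hA with hA | hA <;> rcases hB with hB | hB
  · exact four_bond_core A B αp αm βp βm hAB hA hB
  · have := four_bond_core A B αp αm βm βp hAB hA hB; linarith
  · have := four_bond_core A B αm αp βp βm hAB hA hB; linarith
  · have := four_bond_core A B αm αp βm βp hAB hA hB; linarith

/-! ### Elementary bounds for `cosh` -/

/-- `cosh x - 1 ≤ x²/2 + (x²/2)² e^{x²/2}`. [folklore] -/
private theorem cosh_sub_one_le_sq_add_quarticD (x : ℝ) :
    Real.cosh x - 1 ≤ x ^ 2 / 2 + (x ^ 2 / 2) ^ 2 * Real.exp (x ^ 2 / 2) := by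
  set y : ℝ := x ^ 2 / 2 with hy
  have hy0 : 0 ≤ y := by positivity
  have h1 : Real.cosh x ≤ Real.exp y := Real.cosh_le_exp_half_sq x
  have h2 : 1 - y ≤ Real.exp (-y) := by
    have := Real.add_one_le_exp (-y); linarith
  have h3 : Real.exp y * (1 - y) ≤ 1 := by
    have := mul_le_mul_of_nonneg_left h2 (Real.exp_pos y).le
    rwa [← Real.exp_add, add_neg_cancel, Real.exp_zero] at this
  have h4 : Real.exp y - 1 ≤ y * Real.exp y := by nlinarith
  have h5 : y * Real.exp y ≤ y * (1 + y * Real.exp y) :=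
    mul_le_mul_of_nonneg_left (by linarith) hy0
  nlinarith

/-- One diagonal bond: for `n ≥ 1`, `0 ≤ D ≤ 4n`, `D² ≤ 20 n`,
`cosh(qD/(2n)) - 1 ≤ q² D²/(8n²) + (25/4) q⁴ e^{2q²}/n²`. [folklore] -/
private theorem cosh_bond_sub_one_le (q D n : ℝ) (hn : 1 ≤ n) (hD0 : 0 ≤ D) (hD4 : D ≤ 4 * n)
    (hD20 : D ^ 2 ≤ 20 * n) :
    Real.cosh (q * D / (2 * n)) - 1 ≤
      q ^ 2 * D ^ 2 / (8 * n ^ 2) + 25 / 4 * q ^ 4 * Real.exp (2 * q ^ 2) / n ^ 2 := by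
  have hn0 : 0 < n := by linarith
  set x : ℝ := q * D / (2 * n) with hx
  have hx2 : x ^ 2 = q ^ 2 * D ^ 2 / (4 * n ^ 2) := by
    rw [hx, div_pow, mul_pow]; ring
  have hD16 : D ^ 2 ≤ 16 * n ^ 2 := by nlinarith
  have hx2le' : x ^ 2 ≤ 4 * q ^ 2 := by
    rw [hx2, div_le_iff₀ (by positivity)]
    nlinarith [sq_nonneg q]
  have hhalf : x ^ 2 / 2 ≤ 5 * q ^ 2 / (2 * n) := by
    rw [hx2]
    rw [div_div, div_le_div_iff₀ (by positivity) (by positivity)]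
    have key := mul_le_mul_of_nonneg_left hD20 (show 0 ≤ q ^ 2 * (2 * n) by positivity)
    nlinarith [key]
  have hhalf0 : 0 ≤ x ^ 2 / 2 := by positivity
  have hexp : Real.exp (x ^ 2 / 2) ≤ Real.exp (2 * q ^ 2) := Real.exp_le_exp.2 (by linarith)
  have hquart : (x ^ 2 / 2) ^ 2 * Real.exp (x ^ 2 / 2) ≤
      (5 * q ^ 2 / (2 * n)) ^ 2 * Real.exp (2 * q ^ 2) := by
    gcongr
  calc Real.cosh x - 1 ≤ x ^ 2 / 2 + (x ^ 2 / 2) ^ 2 * Real.exp (x ^ 2 / 2) :=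
        cosh_sub_one_le_sq_add_quarticD x
    _ ≤ x ^ 2 / 2 + (5 * q ^ 2 / (2 * n)) ^ 2 * Real.exp (2 * q ^ 2) := by linarith
    _ = q ^ 2 * D ^ 2 / (8 * n ^ 2) + 25 / 4 * q ^ 4 * Real.exp (2 * q ^ 2) / n ^ 2 := by
        rw [hx2]
        field_simp
        ring

/-- The origin: `4 (cosh(q/2) - 1) ≤ q²/2 + q⁴ e^{2q²}`. [folklore] -/
private theorem four_cosh_half_sub_one_le (q : ℝ) :
    4 * (Real.cosh (q / 2) - 1) ≤ q ^ 2 / 2 + q ^ 4 * Real.exp (2 * q ^ 2) := by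
  have h := cosh_sub_one_le_sq_add_quarticD (q / 2)
  have hx2 : (q / 2) ^ 2 / 2 = q ^ 2 / 8 := by ring
  rw [hx2] at h
  have hexp : Real.exp (q ^ 2 / 8) ≤ Real.exp (2 * q ^ 2) :=
    Real.exp_le_exp.2 (by nlinarith [sq_nonneg q])
  have hq4 : 0 ≤ (q ^ 2 / 8) ^ 2 := sq_nonneg _
  have h2 : (q ^ 2 / 8) ^ 2 * Real.exp (q ^ 2 / 8) ≤ (q ^ 2 / 8) ^ 2 * Real.exp (2 * q ^ 2) :=
    mul_le_mul_of_nonneg_left hexp hq4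
  have hE : 0 ≤ Real.exp (2 * q ^ 2) := (Real.exp_pos _).le
  nlinarith [sq_nonneg q, mul_nonneg (sq_nonneg (q ^ 2)) hE]

/-! ### The truncated logarithmic profile (facts re-derived from the definition) -/

/-- `g_N(n) = 0` for `n ≤ 1`. [folklore] -/
private theorem euclidLogProfile_of_le_oneD (N n : ℕ) (hn : n ≤ 1) : euclidLogProfile N n = 0 := by
  unfold euclidLogProfile
  have : max 1 (min n N) = 1 := by omega
  rw [this]
  simp

/-- `g_N` saturates: `g_N(n) = g_N(N)` for `N ≤ n`. [folklore] -/
private theorem euclidLogProfile_of_geD (N n : ℕ) (hn : N ≤ n) :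
    euclidLogProfile N n = euclidLogProfile N N := by
  unfold euclidLogProfile
  rw [min_eq_right hn, min_self]

/-- `g_{ρ²}(ρ²) = log ρ` for `ρ ≥ 1`. [folklore] -/
private theorem euclidLogProfile_sq_selfD (ρ : ℕ) (hρ : 1 ≤ ρ) :
    euclidLogProfile (ρ ^ 2) (ρ ^ 2) = Real.log ρ := by
  unfold euclidLogProfile
  have h1 : 1 ≤ ρ ^ 2 := Nat.one_le_pow _ _ hρ
  rw [min_self, max_eq_right h1]
  push_cast
  rw [Real.log_pow]
  ring

/-- `g_N` is monotone. [folklore] -/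
private theorem euclidLogProfile_monoD (N : ℕ) {n n' : ℕ} (h : n ≤ n') :
    euclidLogProfile N n ≤ euclidLogProfile N n' := by
  unfold euclidLogProfile
  refine div_le_div_of_nonneg_right ?_ (by norm_num)
  refine Real.log_le_log (by positivity) ?_
  exact_mod_cast (show max 1 (min n N) ≤ max 1 (min n' N) by omega)

/-- `0 ≤ g_N(n) ≤ ½` for `n ≤ 2` (`log 2 ≤ 1`). [folklore] -/
private theorem euclidLogProfile_le_half (N n : ℕ) (hn : n ≤ 2) :
    0 ≤ euclidLogProfile N n ∧ euclidLogProfile N n ≤ 1 / 2 := by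
  unfold euclidLogProfile
  have h1 : (1 : ℝ) ≤ ((max 1 (min n N) : ℕ) : ℝ) := by exact_mod_cast le_max_left _ _
  have h2 : ((max 1 (min n N) : ℕ) : ℝ) ≤ 2 := by exact_mod_cast (show max 1 (min n N) ≤ 2 by omega)
  constructor
  · exact div_nonneg (Real.log_nonneg h1) (by norm_num)
  · have : Real.log (((max 1 (min n N) : ℕ) : ℝ)) ≤ 1 := by
      calc Real.log (((max 1 (min n N) : ℕ) : ℝ)) ≤ ((max 1 (min n N) : ℕ) : ℝ) - 1 :=
            Real.log_le_sub_one_of_pos (by linarith)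
        _ ≤ 1 := by linarith
    linarith

/-- **Gradient bound**: for `1 ≤ n ≤ n'`, `g_N(n') - g_N(n) ≤ (n' - n)/(2n)`. [folklore] -/
private theorem euclidLogProfile_sub_leD (N : ℕ) {n n' : ℕ} (hn : 1 ≤ n) (h : n ≤ n') :
    euclidLogProfile N n' - euclidLogProfile N n ≤ (((n' : ℝ) - n) / n) / 2 := by
  have hn0 : (0:ℝ) < n := by exact_mod_cast hn
  have hnn' : (n:ℝ) ≤ n' := by exact_mod_cast h
  rcases Nat.lt_or_ge n N with hN | hN
  swap
  · rw [euclidLogProfile_of_geD N n hN, euclidLogProfile_of_geD N n' (hN.trans h), sub_self]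
    have : 0 ≤ ((n':ℝ) - n) / n := div_nonneg (by linarith) hn0.le
    linarith
  · unfold euclidLogProfile
    have hM : max 1 (min n N) = n := by omega
    have hM'1 : 1 ≤ max 1 (min n' N) := le_max_left _ _
    have hM'le : max 1 (min n' N) ≤ n' := by omega
    rw [hM, ← sub_div]
    refine div_le_div_of_nonneg_right ?_ (by norm_num)
    have hpos : (0:ℝ) < ((max 1 (min n' N) : ℕ) : ℝ) := by exact_mod_cast hM'1
    rw [← Real.log_div hpos.ne' hn0.ne']
    calc Real.log (((max 1 (min n' N) : ℕ) : ℝ) / n)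
        ≤ ((max 1 (min n' N) : ℕ) : ℝ) / n - 1 := Real.log_le_sub_one_of_pos (by positivity)
      _ ≤ (n' : ℝ) / n - 1 := by
          gcongr
      _ = ((n' : ℝ) - n) / n := by field_simp

/-! ### Counting sites by their cyclic coordinates -/

/-- Only `0` has cyclic absolute value `0`. [folklore] -/
private theorem card_filter_cabs_eq_zero_le : #{v : ZMod L | cabs v = 0} ≤ 1 := by
  have hsub : (univ.filter fun v : ZMod L => cabs v = 0) ⊆ {0} := by
    intro v hv
    simp only [mem_filter, mem_univ, true_and, cabs] at hv
    have hvL := ZMod.val_lt v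
    have : v.val = 0 := by omega
    rw [mem_singleton]
    exact (ZMod.val_eq_zero v).1 this
  exact (card_le_card hsub).trans (card_singleton _).le

/-- The number of sites with prescribed cyclic coordinates `(a, b)` is at most `μ_a μ_b`
(`μ_0 = 1`, `μ_k = 2`). [folklore] -/
private theorem card_filter_cabs_coords_le (a b : ℕ) :
    (#{z : TorusSite 2 L | cabs (z 0) = a ∧ cabs (z 1) = b} : ℝ) ≤
      (if a = 0 then (1:ℝ) else 2) * (if b = 0 then (1:ℝ) else 2) := by
  classical
  have hμ : ∀ k : ℕ, (#{v : ZMod L | cabs v = k} : ℝ) ≤ (if k = 0 then (1:ℝ) else 2) := by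
    intro k
    split_ifs with hk
    · subst hk
      exact_mod_cast (card_filter_cabs_eq_zero_le (L := L))
    · have := card_filter_cyclicAbs_eq_le (L := L) k
      exact_mod_cast this
  have hprod : #{z : TorusSite 2 L | cabs (z 0) = a ∧ cabs (z 1) = b} ≤
      #{v : ZMod L | cabs v = a} * #{v : ZMod L | cabs v = b} := by
    rw [← card_product]
    refine card_le_card_of_injOn (fun z => (z 0, z 1)) (fun z hz => ?_) (fun z _ w _ hzw => ?_)
    · simp only [coe_filter, mem_univ, true_and, Set.mem_setOf_eq] at hz
      simp only [coe_product, coe_filter, Set.mem_prod, Set.mem_setOf_eq, mem_univ, true_and]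
      exact hz
    · have h0 : z 0 = w 0 := congrArg Prod.fst hzw
      have h1 : z 1 = w 1 := congrArg Prod.snd hzw
      funext j
      have hj : j = 0 ∨ j = 1 := by fin_cases j <;> simp
      rcases hj with rfl | rfl
      · exact h0
      · exact h1
  have hcast : (#{z : TorusSite 2 L | cabs (z 0) = a ∧ cabs (z 1) = b} : ℝ) ≤
      (#{v : ZMod L | cabs v = a} : ℝ) * (#{v : ZMod L | cabs v = b} : ℝ) := by
    exact_mod_cast hprod
  refine hcast.trans (mul_le_mul (hμ a) (hμ b) (by positivity) ?_)
  split_ifs <;> norm_num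

/-- The indicator of the origin sums to at most its value over the box. [folklore] -/
private theorem sum_sum_ite_origin_le (ρ : ℕ) (c : ℝ) (hc : 0 ≤ c) :
    ∑ a ∈ range ρ, ∑ b ∈ range ρ, (if a = 0 ∧ b = 0 then c else 0) ≤ c := by
  have hre : ∀ a b : ℕ, (if a = 0 ∧ b = 0 then c else 0) =
      (if a = 0 then (1:ℝ) else 0) * (if b = 0 then c else 0) := by
    intro a b
    by_cases ha : a = 0 <;> by_cases hb : b = 0 <;> simp [ha, hb]
  simp_rw [hre]
  rw [← sum_mul_sum]
  have h1 : ∑ a ∈ range ρ, (if a = 0 then (1:ℝ) else 0) ≤ 1 := by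
    rw [sum_ite_eq' (range ρ) 0 (fun _ => (1:ℝ))]
    split_ifs <;> norm_num
  have h2 : ∑ b ∈ range ρ, (if b = 0 then c else 0) ≤ c := by
    rw [sum_ite_eq' (range ρ) 0 (fun _ => c)]
    split_ifs
    · exact le_rfl
    · exact hc
  have h10 : 0 ≤ ∑ a ∈ range ρ, (if a = 0 then (1:ℝ) else 0) :=
    sum_nonneg fun a _ => by split_ifs <;> norm_num
  have h20 : 0 ≤ ∑ b ∈ range ρ, (if b = 0 then c else 0) :=
    sum_nonneg fun b _ => by split_ifs <;> simp [hc]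
  calc (∑ a ∈ range ρ, (if a = 0 then (1:ℝ) else 0)) * ∑ b ∈ range ρ, (if b = 0 then c else 0)
      ≤ 1 * c := mul_le_mul h1 h2 h20 zero_le_one
    _ = c := one_mul c



/-! ### The outward bond weight and the per-site majorant -/

/-- The monopole potential as a function of the squared norm (plumbing). [folklore] -/
private def dP (q : ℝ) (ρ n : ℕ) : ℝ := q * euclidLogProfile (ρ ^ 2) n

/-- The outward bond weight `[|z|² < |w|²] (cosh(ψ_w - ψ_z) - 1)` (plumbing). [folklore] -/
private def hOut (q : ℝ) (ρ : ℕ) (z w : TorusSite 2 L) : ℝ :=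
  if torusNormSq z < torusNormSq w then
    Real.cosh (dP q ρ (torusNormSq w) - dP q ρ (torusNormSq z)) - 1 else 0

/-- The per-site majorant in terms of the cyclic coordinates `(a, b)` (plumbing). [folklore] -/
private def gMaj (q : ℝ) (ρ a b : ℕ) : ℝ :=
  if a ^ 2 + b ^ 2 < ρ ^ 2 then
    (if a = 0 ∧ b = 0 then q ^ 2 / 2 + q ^ 4 * Real.exp (2 * q ^ 2) else
      q ^ 2 * (((a : ℝ) ^ 2 + (b : ℝ) ^ 2)⁻¹) +
        (2 * q ^ 2 + 25 * q ^ 4 * Real.exp (2 * q ^ 2)) *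
          (((a : ℝ) + b + 1) * ((((a : ℝ) ^ 2 + (b : ℝ) ^ 2) ^ 2)⁻¹)))
  else 0

omit [NeZero L] in
/-- The outward weight is non-negative. [folklore] -/
private theorem hOut_nonneg (q : ℝ) (ρ : ℕ) (z w : TorusSite 2 L) : 0 ≤ hOut q ρ z w := by
  unfold hOut
  split_ifs
  · exact sub_nonneg.2 (Real.one_le_cosh _)
  · exact le_rfl

/-- The majorant is non-negative. [folklore] -/
private theorem gMaj_nonneg (q : ℝ) (ρ a b : ℕ) : 0 ≤ gMaj q ρ a b := by
  unfold gMaj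
  split_ifs
  · positivity
  · positivity
  · exact le_rfl

/-- The majorant vanishes outside the box `a² + b² < ρ²`. [folklore] -/
private theorem gMaj_eq_zero (q : ℝ) (ρ a b : ℕ) (h : ¬ a ^ 2 + b ^ 2 < ρ ^ 2) : gMaj q ρ a b = 0 := by
  unfold gMaj; rw [if_neg h]

omit [NeZero L] in
/-- In the saturated region every outward weight vanishes. [folklore] -/
private theorem hOut_eq_zero_of_sat (q : ℝ) (ρ : ℕ) (z w : TorusSite 2 L)
    (hz : ρ ^ 2 ≤ torusNormSq z) : hOut q ρ z w = 0 := by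
  unfold hOut
  split_ifs with hlt
  · have hPeq : dP q ρ (torusNormSq w) = dP q ρ (torusNormSq z) := by
      simp only [dP, euclidLogProfile_of_geD _ _ hz, euclidLogProfile_of_geD _ _ (hz.trans hlt.le)]
    rw [hPeq, sub_self, Real.cosh_zero, sub_self]
  · rfl

omit [NeZero L] in
/-- A bond out of the origin costs at most `cosh(q/2) - 1`. [folklore] -/
private theorem hOut_origin_le (q : ℝ) (hq : 0 ≤ q) (ρ : ℕ) (z w : TorusSite 2 L)
    (hz : torusNormSq z = 0) (hw : torusNormSq w ≤ 2) : hOut q ρ z w ≤ Real.cosh (q / 2) - 1 := by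
  unfold hOut
  split_ifs with hlt
  · refine sub_le_sub_right (Real.cosh_le_cosh.2 ?_) 1
    have hg := euclidLogProfile_le_half (ρ ^ 2) (torusNormSq w) hw
    have hP0 : dP q ρ (torusNormSq z) = 0 := by
      simp only [dP, hz, euclidLogProfile_of_le_oneD _ _ (Nat.zero_le 1), mul_zero]
    rw [hP0, sub_zero]
    simp only [dP]
    rw [abs_of_nonneg (mul_nonneg hq hg.1), abs_of_nonneg (by positivity : (0:ℝ) ≤ q / 2)]
    calc q * euclidLogProfile (ρ ^ 2) (torusNormSq w) ≤ q * (1 / 2) :=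
          mul_le_mul_of_nonneg_left hg.2 hq
      _ = q / 2 := by ring
  · exact sub_nonneg.2 (Real.one_le_cosh _)

/-- Arithmetic of the cyclic coordinates of a site `≠ 0`: with `n = A² + B²`,
`1 ≤ n`, `A + B + 1 ≤ 2n`, `(A + B + 1)² ≤ 5n`. [folklore] -/
private theorem coords_arith (A B : ℕ) (h00 : ¬ (A = 0 ∧ B = 0)) :
    (1 : ℝ) ≤ (A : ℝ) ^ 2 + (B : ℝ) ^ 2 ∧ (A : ℝ) + B + 1 ≤ 2 * ((A : ℝ) ^ 2 + (B : ℝ) ^ 2) ∧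
      ((A : ℝ) + B + 1) ^ 2 ≤ 5 * ((A : ℝ) ^ 2 + (B : ℝ) ^ 2) := by
  rcases Nat.eq_zero_or_pos A with hA0 | hA0
  · have hB : B ≠ 0 := fun hB => h00 ⟨hA0, hB⟩
    have hB1 : (1 : ℝ) ≤ B := by exact_mod_cast Nat.one_le_iff_ne_zero.2 hB
    have hA0r : (A : ℝ) = 0 := by exact_mod_cast hA0
    rw [hA0r]
    refine ⟨by nlinarith, by nlinarith, by nlinarith⟩
  · have hA1 : (1 : ℝ) ≤ A := by exact_mod_cast hA0
    rcases Nat.eq_zero_or_pos B with hB0 | hB0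
    · have hB0r : (B : ℝ) = 0 := by exact_mod_cast hB0
      rw [hB0r]
      refine ⟨by nlinarith, by nlinarith, by nlinarith⟩
    · have hB1 : (1 : ℝ) ≤ B := by exact_mod_cast hB0
      refine ⟨by nlinarith, by nlinarith, by nlinarith [sq_nonneg ((A : ℝ) - B)]⟩

omit [NeZero L] in
/-- **One diagonal bond.** At a site with cyclic coordinates `(A, B) ≠ (0, 0)`, `n = A² + B²`,
a neighbour with cyclic coordinates `(a', b')`, `a' ≤ A + 1`, `b' ≤ B + 1`, has outward weight
`≤ q² Δ₊²/(8n²) + (25/4) q⁴ e^{2q²}/n²`, `Δ = (a'² - A²) + (b'² - B²)`. [folklore] -/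
private theorem hOut_bond_le (q : ℝ) (hq : 0 ≤ q) (ρ : ℕ) (z w : TorusSite 2 L) (A B a' b' : ℕ)
    (hA : cabs (z 0) = A) (hB : cabs (z 1) = B) (ha' : cabs (w 0) = a') (hb' : cabs (w 1) = b')
    (h00 : ¬ (A = 0 ∧ B = 0)) (haA : a' ≤ A + 1) (hbB : b' ≤ B + 1) :
    hOut q ρ z w ≤
      q ^ 2 / (8 * ((A : ℝ) ^ 2 + (B : ℝ) ^ 2) ^ 2) *
          ((max (((a' : ℤ) ^ 2 - (A : ℤ) ^ 2) + ((b' : ℤ) ^ 2 - (B : ℤ) ^ 2)) 0 : ℤ) : ℝ) ^ 2 +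
        25 / 4 * q ^ 4 * Real.exp (2 * q ^ 2) / ((A : ℝ) ^ 2 + (B : ℝ) ^ 2) ^ 2 := by
  obtain ⟨hnR1, hlin, hquad⟩ := coords_arith A B h00
  set nR : ℝ := (A : ℝ) ^ 2 + (B : ℝ) ^ 2 with hnRdef
  have hnR0 : 0 < nR := by linarith
  have hnAB : torusNormSq z = A ^ 2 + B ^ 2 := by rw [torusNormSq_eq_cabs, hA, hB]
  have hnw : torusNormSq w = a' ^ 2 + b' ^ 2 := by rw [torusNormSq_eq_cabs, ha', hb']
  have hn1 : 1 ≤ torusNormSq z := by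
    have : (1 : ℝ) ≤ ((torusNormSq z : ℕ) : ℝ) := by rw [hnAB]; push_cast; linarith
    exact_mod_cast this
  have hnR : ((torusNormSq z : ℕ) : ℝ) = nR := by rw [hnAB]; push_cast; ring
  set Δ : ℤ := ((a' : ℤ) ^ 2 - (A : ℤ) ^ 2) + ((b' : ℤ) ^ 2 - (B : ℤ) ^ 2) with hΔ
  set D : ℝ := ((max Δ 0 : ℤ) : ℝ) with hD
  have hD0 : 0 ≤ D := by rw [hD]; exact_mod_cast le_max_right _ _
  have hΔle : Δ ≤ 2 * ((A : ℤ) + B + 1) := by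
    have h1 : (a' : ℤ) ≤ A + 1 := by exact_mod_cast haA
    have h2 : (b' : ℤ) ≤ B + 1 := by exact_mod_cast hbB
    have h3 : (0 : ℤ) ≤ a' := Int.natCast_nonneg _
    have h4 : (0 : ℤ) ≤ b' := Int.natCast_nonneg _
    rw [hΔ]; nlinarith
  have hDle : D ≤ 2 * ((A : ℝ) + B + 1) := by
    have : (max Δ 0 : ℤ) ≤ 2 * ((A : ℤ) + B + 1) := max_le hΔle (by positivity)
    rw [hD]; exact_mod_cast this
  have hD4 : D ≤ 4 * nR := by linarith
  have hD20 : D ^ 2 ≤ 20 * nR := by nlinarith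
  have hrhs0 : 0 ≤ q ^ 2 / (8 * nR ^ 2) * D ^ 2 + 25 / 4 * q ^ 4 * Real.exp (2 * q ^ 2) / nR ^ 2 := by
    positivity
  unfold hOut
  split_ifs with hlt
  · -- an outward bond: `Δ = |w|² - |z|² > 0`
    have hΔeq : ((torusNormSq w : ℕ) : ℝ) - (torusNormSq z : ℕ) = (Δ : ℝ) := by
      rw [hnw, hnAB, hΔ]; push_cast; ring
    have hΔpos : 0 < Δ := by
      have h1 : ((torusNormSq z : ℕ) : ℝ) < (torusNormSq w : ℕ) := by exact_mod_cast hlt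
      have h2 : (0 : ℝ) < (Δ : ℝ) := by rw [← hΔeq]; linarith
      exact_mod_cast h2
    have hDeq : D = (Δ : ℝ) := by rw [hD, max_eq_left hΔpos.le]
    have hPmono : dP q ρ (torusNormSq z) ≤ dP q ρ (torusNormSq w) :=
      mul_le_mul_of_nonneg_left (euclidLogProfile_monoD _ hlt.le) hq
    have hdiff0 : 0 ≤ dP q ρ (torusNormSq w) - dP q ρ (torusNormSq z) := sub_nonneg.2 hPmono
    have hbnd : dP q ρ (torusNormSq w) - dP q ρ (torusNormSq z) ≤ q * D / (2 * nR) := by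
      have hsub := euclidLogProfile_sub_leD (ρ ^ 2) hn1 hlt.le
      rw [hΔeq, hnR] at hsub
      simp only [dP, ← mul_sub]
      calc q * (euclidLogProfile (ρ ^ 2) (torusNormSq w) - euclidLogProfile (ρ ^ 2) (torusNormSq z))
          ≤ q * (((Δ : ℝ) / nR) / 2) := mul_le_mul_of_nonneg_left hsub hq
        _ = q * D / (2 * nR) := by rw [hDeq]; field_simp
    have hqD0 : 0 ≤ q * D / (2 * nR) := by positivity
    calc Real.cosh (dP q ρ (torusNormSq w) - dP q ρ (torusNormSq z)) - 1
        ≤ Real.cosh (q * D / (2 * nR)) - 1 := by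
          refine sub_le_sub_right (Real.cosh_le_cosh.2 ?_) 1
          rw [abs_of_nonneg hdiff0, abs_of_nonneg hqD0]
          exact hbnd
      _ ≤ q ^ 2 * D ^ 2 / (8 * nR ^ 2) + 25 / 4 * q ^ 4 * Real.exp (2 * q ^ 2) / nR ^ 2 :=
          cosh_bond_sub_one_le q D nR hnR1 hD0 hD4 hD20
      _ = q ^ 2 / (8 * nR ^ 2) * D ^ 2 + 25 / 4 * q ^ 4 * Real.exp (2 * q ^ 2) / nR ^ 2 := by
          ring
  · exact hrhs0

omit [NeZero L] in
/-- Coordinates of the four diagonal neighbours. [folklore] -/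
private theorem diagNeighbour_coords (z : TorusSite 2 L) :
    ((z + torusDiagJump L 0) 0 = z 0 + 1 ∧ (z + torusDiagJump L 0) 1 = z 1 + 1) ∧
    ((z - torusDiagJump L 0) 0 = z 0 - 1 ∧ (z - torusDiagJump L 0) 1 = z 1 - 1) ∧
    ((z + torusDiagJump L 1) 0 = z 0 + 1 ∧ (z + torusDiagJump L 1) 1 = z 1 - 1) ∧
    ((z - torusDiagJump L 1) 0 = z 0 - 1 ∧ (z - torusDiagJump L 1) 1 = z 1 + 1) := by
  refine ⟨⟨by simp, by simp [torusDiagJump_apply_one]⟩, ⟨by simp, by simp [torusDiagJump_apply_one]⟩,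
    ⟨by simp, ?_⟩, ⟨by simp, ?_⟩⟩
  · simp [torusDiagJump_apply_one, sub_eq_add_neg]
  · simp [torusDiagJump_apply_one]

/-- Assembling the four bonds at a generic site (`s = A + B`, `n = A² + B² ≥ 1`). [folklore] -/
private theorem site_assemble (q s nR E : ℝ) (hnR : 1 ≤ nR) (hs : 0 ≤ s) (hE : 0 ≤ E) :
    q ^ 2 / (8 * nR ^ 2) * (8 * nR + 16 * s + 12) + 4 * (25 / 4 * q ^ 4 * E / nR ^ 2) ≤
      q ^ 2 * nR⁻¹ + (2 * q ^ 2 + 25 * q ^ 4 * E) * ((s + 1) * (nR ^ 2)⁻¹) := by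
  have hnR0 : 0 < nR := by linarith
  have key : q ^ 2 * nR⁻¹ + (2 * q ^ 2 + 25 * q ^ 4 * E) * ((s + 1) * (nR ^ 2)⁻¹) -
      (q ^ 2 / (8 * nR ^ 2) * (8 * nR + 16 * s + 12) + 4 * (25 / 4 * q ^ 4 * E / nR ^ 2)) =
      (q ^ 2 / 2 + 25 * q ^ 4 * E * s) / nR ^ 2 := by
    field_simp
    ring
  have : 0 ≤ (q ^ 2 / 2 + 25 * q ^ 4 * E * s) / nR ^ 2 := by positivity
  linarith

/-- **The per-site bound**: the four outward diagonal weights at `z` are bounded by the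
majorant `gMaj` of its cyclic coordinates. [folklore] -/
private theorem four_hOut_le_gMaj (q : ℝ) (hq : 0 ≤ q) (ρ : ℕ) (z : TorusSite 2 L) :
    hOut q ρ z (z + torusDiagJump L 0) + hOut q ρ z (z - torusDiagJump L 0) +
        (hOut q ρ z (z + torusDiagJump L 1) + hOut q ρ z (z - torusDiagJump L 1)) ≤
      gMaj q ρ (cabs (z 0)) (cabs (z 1)) := by
  obtain ⟨⟨e1, e2⟩, ⟨e3, e4⟩, ⟨e5, e6⟩, ⟨e7, e8⟩⟩ := diagNeighbour_coords z
  have hnAB : torusNormSq z = cabs (z 0) ^ 2 + cabs (z 1) ^ 2 := torusNormSq_eq_cabs z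
  have hs0 := cabs_add_one_le (z 0)
  have hs1 := cabs_add_one_le (z 1)
  by_cases hbox : cabs (z 0) ^ 2 + cabs (z 1) ^ 2 < ρ ^ 2
  · by_cases h00 : cabs (z 0) = 0 ∧ cabs (z 1) = 0
    · -- the origin: four bonds of cost `≤ cosh(q/2) - 1`
      have hGval : gMaj q ρ (cabs (z 0)) (cabs (z 1)) = q ^ 2 / 2 + q ^ 4 * Real.exp (2 * q ^ 2) := by
        unfold gMaj; rw [if_pos hbox, if_pos h00]
      rw [hGval]
      have hz0 : torusNormSq z = 0 := by rw [hnAB, h00.1, h00.2]; norm_num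
      have Hw : ∀ w : TorusSite 2 L, cabs (w 0) ≤ 1 → cabs (w 1) ≤ 1 →
          hOut q ρ z w ≤ Real.cosh (q / 2) - 1 := by
        intro w h0 h1
        refine hOut_origin_le q hq ρ z w hz0 ?_
        rw [torusNormSq_eq_cabs]
        nlinarith
      have hA0 := h00.1
      have hB0 := h00.2
      have w1 := Hw (z + torusDiagJump L 0) (by rw [e1]; omega) (by rw [e2]; omega)
      have w2 := Hw (z - torusDiagJump L 0) (by rw [e3]; omega) (by rw [e4]; omega)
      have w3 := Hw (z + torusDiagJump L 1) (by rw [e5]; omega) (by rw [e6]; omega)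
      have w4 := Hw (z - torusDiagJump L 1) (by rw [e7]; omega) (by rw [e8]; omega)
      have hfour := four_cosh_half_sub_one_le q
      linarith
    · -- the generic site `1 ≤ |z|² < ρ²`
      set A : ℕ := cabs (z 0) with hAdef
      set B : ℕ := cabs (z 1) with hBdef
      have hGval : gMaj q ρ A B = q ^ 2 * (((A : ℝ) ^ 2 + (B : ℝ) ^ 2)⁻¹) +
          (2 * q ^ 2 + 25 * q ^ 4 * Real.exp (2 * q ^ 2)) *
            (((A : ℝ) + B + 1) * ((((A : ℝ) ^ 2 + (B : ℝ) ^ 2) ^ 2)⁻¹)) := by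
        unfold gMaj; rw [if_pos hbox, if_neg h00]
      rw [hGval]
      -- the four bonds
      have w1 := hOut_bond_le q hq ρ z (z + torusDiagJump L 0) A B (cabs (z 0 + 1)) (cabs (z 1 + 1))
        hAdef.symm hBdef.symm (by rw [e1]) (by rw [e2]) h00 hs0.1 hs1.1
      have w2 := hOut_bond_le q hq ρ z (z - torusDiagJump L 0) A B (cabs (z 0 - 1)) (cabs (z 1 - 1))
        hAdef.symm hBdef.symm (by rw [e3]) (by rw [e4]) h00 hs0.2 hs1.2
      have w3 := hOut_bond_le q hq ρ z (z + torusDiagJump L 1) A B (cabs (z 0 + 1)) (cabs (z 1 - 1))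
        hAdef.symm hBdef.symm (by rw [e5]) (by rw [e6]) h00 hs0.1 hs1.2
      have w4 := hOut_bond_le q hq ρ z (z - torusDiagJump L 1) A B (cabs (z 0 - 1)) (cabs (z 1 + 1))
        hAdef.symm hBdef.symm (by rw [e7]) (by rw [e8]) h00 hs0.2 hs1.1
      -- the integer four-bond inequality
      have hint := four_bond_sum_le A B
        (((cabs (z 0 + 1) : ℕ) : ℤ) ^ 2 - (A : ℤ) ^ 2) (((cabs (z 0 - 1) : ℕ) : ℤ) ^ 2 - (A : ℤ) ^ 2)
        (((cabs (z 1 + 1) : ℕ) : ℤ) ^ 2 - (B : ℤ) ^ 2) (((cabs (z 1 - 1) : ℕ) : ℤ) ^ 2 - (B : ℤ) ^ 2)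
        h00 (coordCore_of_cyclicAbs (z 0)) (coordCore_of_cyclicAbs (z 1))
      obtain ⟨hnR1, -, -⟩ := coords_arith A B h00
      set nR : ℝ := (A : ℝ) ^ 2 + (B : ℝ) ^ 2 with hnRdef
      set E : ℝ := Real.exp (2 * q ^ 2) with hE
      have hintR :
          ((max ((((cabs (z 0 + 1) : ℕ) : ℤ) ^ 2 - (A : ℤ) ^ 2) +
              ((((cabs (z 1 + 1) : ℕ) : ℤ) ^ 2 - (B : ℤ) ^ 2))) 0 : ℤ) : ℝ) ^ 2 +
          ((max ((((cabs (z 0 + 1) : ℕ) : ℤ) ^ 2 - (A : ℤ) ^ 2) +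
              ((((cabs (z 1 - 1) : ℕ) : ℤ) ^ 2 - (B : ℤ) ^ 2))) 0 : ℤ) : ℝ) ^ 2 +
          ((max ((((cabs (z 0 - 1) : ℕ) : ℤ) ^ 2 - (A : ℤ) ^ 2) +
              ((((cabs (z 1 + 1) : ℕ) : ℤ) ^ 2 - (B : ℤ) ^ 2))) 0 : ℤ) : ℝ) ^ 2 +
          ((max ((((cabs (z 0 - 1) : ℕ) : ℤ) ^ 2 - (A : ℤ) ^ 2) +
              ((((cabs (z 1 - 1) : ℕ) : ℤ) ^ 2 - (B : ℤ) ^ 2))) 0 : ℤ) : ℝ) ^ 2 ≤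
            8 * nR + 16 * ((A : ℝ) + B) + 12 := by
        have := (Int.cast_le (R := ℝ)).2 hint
        push_cast at this ⊢
        rw [hnRdef]
        linarith
      have hq8 : 0 ≤ q ^ 2 / (8 * nR ^ 2) := by positivity
      have hkey := mul_le_mul_of_nonneg_left hintR hq8
      have hA0 : (0 : ℝ) ≤ A := Nat.cast_nonneg A
      have hB0 : (0 : ℝ) ≤ B := Nat.cast_nonneg B
      have hfin := site_assemble q ((A : ℝ) + B) nR E hnR1 (by positivity) (Real.exp_pos _).le
      linarith
  · -- the saturated region (and `ρ = 0`)
    rw [gMaj_eq_zero q ρ _ _ hbox]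
    have hzb : ρ ^ 2 ≤ torusNormSq z := by rw [hnAB]; exact not_lt.1 hbox
    simp only [hOut_eq_zero_of_sat q ρ z _ hzb]
    norm_num

/-- From the adjacency indicator to the four candidate neighbours. [folklore] -/
private theorem sum_adj_hOut_le (q : ℝ) (ρ : ℕ) (z : TorusSite 2 L) :
    ∑ w : TorusSite 2 L, (if (torusDiagGraph L).Adj z w then hOut q ρ z w else 0) ≤
      hOut q ρ z (z + torusDiagJump L 0) + hOut q ρ z (z - torusDiagJump L 0) +
        (hOut q ρ z (z + torusDiagJump L 1) + hOut q ρ z (z - torusDiagJump L 1)) := by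
  classical
  have hh0 := hOut_nonneg (L := L) q ρ
  have HA : ∑ w : TorusSite 2 L, (if (torusDiagGraph L).Adj z w then hOut q ρ z w else 0) ≤
      ∑ w : TorusSite 2 L, ∑ s : Fin 2,
        ((if w = z + torusDiagJump L s then hOut q ρ z w else 0) +
          (if w = z - torusDiagJump L s then hOut q ρ z w else 0)) := by
    refine sum_le_sum fun w _ => ?_
    have hterm0 : ∀ j : Fin 2, 0 ≤ (if w = z + torusDiagJump L j then hOut q ρ z w else 0) +
        (if w = z - torusDiagJump L j then hOut q ρ z w else 0) := fun j =>
      add_nonneg (by split_ifs <;> simp [hh0]) (by split_ifs <;> simp [hh0])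
    split_ifs with hzw
    · obtain ⟨-, ⟨s, hs⟩ | ⟨s, hs⟩⟩ := (torusDiagGraph_adj_iff z w).1 hzw
      · refine le_trans ?_ (single_le_sum (fun j _ => hterm0 j) (mem_univ s))
        rw [if_pos hs]
        have : 0 ≤ (if w = z - torusDiagJump L s then hOut q ρ z w else 0) := by
          split_ifs <;> simp [hh0]
        linarith
      · have hs' : w = z - torusDiagJump L s := by rw [hs, add_sub_cancel_right]
        refine le_trans ?_ (single_le_sum (fun j _ => hterm0 j) (mem_univ s))
        rw [if_pos hs']
        have : 0 ≤ (if w = z + torusDiagJump L s then hOut q ρ z w else 0) := by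
          split_ifs <;> simp [hh0]
        linarith
    · exact sum_nonneg fun j _ => hterm0 j
  have HA' : ∑ w : TorusSite 2 L, ∑ s : Fin 2,
      ((if w = z + torusDiagJump L s then hOut q ρ z w else 0) +
        (if w = z - torusDiagJump L s then hOut q ρ z w else 0)) =
      ∑ s : Fin 2, (hOut q ρ z (z + torusDiagJump L s) + hOut q ρ z (z - torusDiagJump L s)) := by
    rw [sum_comm]
    refine sum_congr rfl fun s _ => ?_
    rw [sum_add_distrib, sum_ite_eq' univ (z + torusDiagJump L s) (hOut q ρ z),
      sum_ite_eq' univ (z - torusDiagJump L s) (hOut q ρ z)]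
    simp
  refine (HA.trans_eq HA').trans_eq ?_
  rw [Fin.sum_univ_two]

/-- Counting the sites by their cyclic coordinates. [folklore] -/
private theorem sum_gMaj_le (q : ℝ) (ρ : ℕ) :
    ∑ z : TorusSite 2 L, gMaj q ρ (cabs (z 0)) (cabs (z 1)) ≤
      ∑ p ∈ range ρ ×ˢ range ρ,
        (if p.1 = 0 then (1:ℝ) else 2) * (if p.2 = 0 then (1:ℝ) else 2) * gMaj q ρ p.1 p.2 := by
  classical
  set T : Finset (ℕ × ℕ) := range ρ ×ˢ range ρ with hT
  set c : TorusSite 2 L → ℕ × ℕ := fun z => (cabs (z 0), cabs (z 1)) with hc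
  calc ∑ z : TorusSite 2 L, gMaj q ρ (cabs (z 0)) (cabs (z 1))
      = ∑ z : TorusSite 2 L, gMaj q ρ (c z).1 (c z).2 := by simp only [hc]
    _ ≤ ∑ z : TorusSite 2 L, ∑ p ∈ T, (if c z = p then gMaj q ρ p.1 p.2 else 0) := by
        refine sum_le_sum fun z _ => ?_
        rw [sum_ite_eq]
        split_ifs with hzT
        · exact le_rfl
        · rw [gMaj_eq_zero]
          intro hcond
          apply hzT
          simp only [hT, mem_product, mem_range]
          constructor <;> nlinarith [hcond]
    _ = ∑ p ∈ T, ∑ z : TorusSite 2 L, (if c z = p then gMaj q ρ p.1 p.2 else 0) := sum_comm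
    _ = ∑ p ∈ T, gMaj q ρ p.1 p.2 * (#{z : TorusSite 2 L | c z = p} : ℝ) := by
        refine sum_congr rfl fun p _ => ?_
        rw [← sum_filter, sum_const, nsmul_eq_mul, mul_comm]
    _ ≤ ∑ p ∈ T, (if p.1 = 0 then (1:ℝ) else 2) * (if p.2 = 0 then (1:ℝ) else 2) * gMaj q ρ p.1 p.2 := by
        refine sum_le_sum fun p _ => ?_
        have hcard : (#{z : TorusSite 2 L | c z = p} : ℝ) ≤
            (if p.1 = 0 then (1:ℝ) else 2) * (if p.2 = 0 then (1:ℝ) else 2) := by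
          have := card_filter_cabs_coords_le (L := L) p.1 p.2
          refine le_trans (le_of_eq ?_) this
          congr 2
          ext z
          simp only [mem_filter, mem_univ, true_and, hc, Prod.ext_iff]
        calc gMaj q ρ p.1 p.2 * (#{z : TorusSite 2 L | c z = p} : ℝ)
            ≤ gMaj q ρ p.1 p.2 * ((if p.1 = 0 then (1:ℝ) else 2) * (if p.2 = 0 then (1:ℝ) else 2)) :=
              mul_le_mul_of_nonneg_left hcard (gMaj_nonneg _ _ _ _)
          _ = _ := by ring

/-- The lattice sums: `Σ_{a,b<ρ} μ_a μ_b gMaj(a,b) ≤ q²(2π H(ρ) + 8) + 68(2q² + 25q⁴e^{2q²}) +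
(q²/2 + q⁴ e^{2q²})`. [folklore] -/
private theorem sum_weighted_gMaj_le (q : ℝ) (ρ : ℕ) :
    ∑ p ∈ range ρ ×ˢ range ρ,
        (if p.1 = 0 then (1:ℝ) else 2) * (if p.2 = 0 then (1:ℝ) else 2) * gMaj q ρ p.1 p.2 ≤
      q ^ 2 * (2 * Real.pi * (harmonic ρ : ℝ) + 8) +
        (2 * q ^ 2 + 25 * q ^ 4 * Real.exp (2 * q ^ 2)) * 68 +
        (q ^ 2 / 2 + q ^ 4 * Real.exp (2 * q ^ 2)) := by
  set μ : ℕ → ℝ := fun k => if k = 0 then (1:ℝ) else 2 with hμ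
  have hμ0 : ∀ k, 0 ≤ μ k := fun k => by by_cases hk : k = 0 <;> simp [hμ, hk]
  set E : ℝ := Real.exp (2 * q ^ 2) with hE
  set Cq : ℝ := 2 * q ^ 2 + 25 * q ^ 4 * E with hCq
  have hCq0 : 0 ≤ Cq := by positivity
  set c0 : ℝ := q ^ 2 / 2 + q ^ 4 * E with hc0
  have hc00 : 0 ≤ c0 := by positivity
  have hpoint : ∀ a b : ℕ, μ a * μ b * gMaj q ρ a b ≤
      q ^ 2 * (if a = 0 ∧ b = 0 then (0:ℝ) else μ a * μ b * (((a : ℝ) ^ 2 + (b : ℝ) ^ 2)⁻¹)) +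
        Cq * (if a = 0 ∧ b = 0 then (0:ℝ) else
          μ a * μ b * (((a : ℝ) + b + 1) * ((((a : ℝ) ^ 2 + (b : ℝ) ^ 2) ^ 2)⁻¹))) +
        (if a = 0 ∧ b = 0 then c0 else 0) := by
    intro a b
    have hμμ : 0 ≤ μ a * μ b := mul_nonneg (hμ0 a) (hμ0 b)
    by_cases hbox : a ^ 2 + b ^ 2 < ρ ^ 2
    · by_cases h00 : a = 0 ∧ b = 0
      · have hGab : gMaj q ρ a b = c0 := by unfold gMaj; rw [if_pos hbox, if_pos h00]
        have hμa : μ a = 1 := by simp only [hμ, if_pos h00.1]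
        have hμb : μ b = 1 := by simp only [hμ, if_pos h00.2]
        rw [hGab, if_pos h00, if_pos h00, if_pos h00, hμa, hμb]
        simp
      · have hGab : gMaj q ρ a b = q ^ 2 * (((a : ℝ) ^ 2 + (b : ℝ) ^ 2)⁻¹) +
            Cq * (((a : ℝ) + b + 1) * ((((a : ℝ) ^ 2 + (b : ℝ) ^ 2) ^ 2)⁻¹)) := by
          unfold gMaj; rw [if_pos hbox, if_neg h00]
        rw [hGab, if_neg h00, if_neg h00, if_neg h00]
        linarith [le_refl (μ a * μ b)]
    · rw [gMaj_eq_zero q ρ a b hbox, mul_zero]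
      have h1 : 0 ≤ (if a = 0 ∧ b = 0 then (0:ℝ) else
          μ a * μ b * (((a : ℝ) ^ 2 + (b : ℝ) ^ 2)⁻¹)) := by
        split_ifs
        · exact le_rfl
        · exact mul_nonneg hμμ (by positivity)
      have h2 : 0 ≤ (if a = 0 ∧ b = 0 then (0:ℝ) else
          μ a * μ b * (((a : ℝ) + b + 1) * ((((a : ℝ) ^ 2 + (b : ℝ) ^ 2) ^ 2)⁻¹))) := by
        split_ifs
        · exact le_rfl
        · exact mul_nonneg hμμ (by positivity)
      have h3 : 0 ≤ (if a = 0 ∧ b = 0 then c0 else 0) := by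
        split_ifs
        · exact hc00
        · exact le_rfl
      positivity
  have hS1 := sum_sum_inv_normSq_le ρ
  have hS2 := sum_sum_secondary_le ρ
  have hS3 := sum_sum_ite_origin_le ρ c0 hc00
  rw [sum_product]
  calc ∑ a ∈ range ρ, ∑ b ∈ range ρ, μ a * μ b * gMaj q ρ a b
      ≤ ∑ a ∈ range ρ, ∑ b ∈ range ρ,
          (q ^ 2 * (if a = 0 ∧ b = 0 then (0:ℝ) else
              μ a * μ b * (((a : ℝ) ^ 2 + (b : ℝ) ^ 2)⁻¹)) +
            Cq * (if a = 0 ∧ b = 0 then (0:ℝ) else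
              μ a * μ b * (((a : ℝ) + b + 1) * ((((a : ℝ) ^ 2 + (b : ℝ) ^ 2) ^ 2)⁻¹))) +
            (if a = 0 ∧ b = 0 then c0 else 0)) :=
        sum_le_sum fun a _ => sum_le_sum fun b _ => hpoint a b
    _ = q ^ 2 * ∑ a ∈ range ρ, ∑ b ∈ range ρ,
            (if a = 0 ∧ b = 0 then (0:ℝ) else μ a * μ b * (((a : ℝ) ^ 2 + (b : ℝ) ^ 2)⁻¹)) +
          Cq * ∑ a ∈ range ρ, ∑ b ∈ range ρ,
            (if a = 0 ∧ b = 0 then (0:ℝ) else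
              μ a * μ b * (((a : ℝ) + b + 1) * ((((a : ℝ) ^ 2 + (b : ℝ) ^ 2) ^ 2)⁻¹))) +
          ∑ a ∈ range ρ, ∑ b ∈ range ρ, (if a = 0 ∧ b = 0 then c0 else 0) := by
        simp only [sum_add_distrib, mul_sum]
    _ ≤ q ^ 2 * (2 * Real.pi * (harmonic ρ : ℝ) + 8) + Cq * 68 + c0 := by
        have hq2 : 0 ≤ q ^ 2 := by positivity
        simp only [hμ] at hS1 hS2 ⊢
        exact add_le_add (add_le_add (mul_le_mul_of_nonneg_left hS1 hq2)
          (mul_le_mul_of_nonneg_left hS2 hCq0)) hS3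

/-! ### The diagonal energy of the Euclidean logarithmic monopole -/

/-- **Diagonal energy of the Euclidean logarithmic monopole (centred at `0`).** On `(ℤ/Lℤ)²`,
for `q ≥ 0` and every radius `ρ`, the potential `ψ(z) = q g_{ρ²}(|z|₂²)` has
`Σ_z Σ_w [z ∼_diag w] (cosh(ψ_z - ψ_w) - 1) ≤ 4π q² H(ρ) + 289 q² + 3402 q⁴ e^{2q²}`, uniformly
in `L` — twice the nearest-neighbour coefficient `2π` (`|e₁ ± e₂|₂² = 2`). Koma–Tasaki, PRL 68
(1992) 3248, proof of eq. (13), property P2, with note 9 (finite-range hopping); explicit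
Euclidean-logarithm version. [cite: KomaTasakiPRL1992, proof of eq. (13) (P2) and note 9] -/
theorem euclidLogMonopole_diagEnergy_le_origin (q : ℝ) (hq : 0 ≤ q) (ρ : ℕ) :
    ∑ z : TorusSite 2 L, ∑ w : TorusSite 2 L,
        (if (torusDiagGraph L).Adj z w then
          (Real.cosh (q * euclidLogProfile (ρ ^ 2) (torusNormSq z) -
              q * euclidLogProfile (ρ ^ 2) (torusNormSq w)) - 1)
        else 0) ≤
      4 * Real.pi * q ^ 2 * (harmonic ρ : ℝ) + 289 * q ^ 2 +
        3402 * q ^ 4 * Real.exp (2 * q ^ 2) := by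
  classical
  -- (1) the bond term is the outward weight in one of the two directions
  have hedge : ∀ z w : TorusSite 2 L,
      Real.cosh (q * euclidLogProfile (ρ ^ 2) (torusNormSq z) -
          q * euclidLogProfile (ρ ^ 2) (torusNormSq w)) - 1 = hOut q ρ z w + hOut q ρ w z := by
    intro z w
    rcases Nat.lt_trichotomy (torusNormSq z) (torusNormSq w) with hlt | heq | hgt
    · simp only [hOut, dP, if_pos hlt, if_neg (Nat.lt_asymm hlt), add_zero]
      rw [← Real.cosh_neg, neg_sub]
    · simp only [hOut, heq, lt_irrefl, if_false, add_zero, sub_self, Real.cosh_zero]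
    · simp only [hOut, dP, if_pos hgt, if_neg (Nat.lt_asymm hgt), zero_add]
  -- (2) symmetrise
  have hsum : (∑ z : TorusSite 2 L, ∑ w : TorusSite 2 L,
      (if (torusDiagGraph L).Adj z w then
        (Real.cosh (q * euclidLogProfile (ρ ^ 2) (torusNormSq z) -
            q * euclidLogProfile (ρ ^ 2) (torusNormSq w)) - 1) else 0)) =
      2 * ∑ z : TorusSite 2 L, ∑ w : TorusSite 2 L,
        (if (torusDiagGraph L).Adj z w then hOut q ρ z w else 0) := by
    have hsplit : ∀ z w : TorusSite 2 L,
        (if (torusDiagGraph L).Adj z w then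
          (Real.cosh (q * euclidLogProfile (ρ ^ 2) (torusNormSq z) -
              q * euclidLogProfile (ρ ^ 2) (torusNormSq w)) - 1) else 0) =
        (if (torusDiagGraph L).Adj z w then hOut q ρ z w else 0) +
          (if (torusDiagGraph L).Adj w z then hOut q ρ w z else 0) := by
      intro z w
      by_cases hzw : (torusDiagGraph L).Adj z w
      · rw [if_pos hzw, if_pos hzw, if_pos ((torusDiagGraph L).adj_symm hzw), hedge z w]
      · rw [if_neg hzw, if_neg hzw, if_neg (fun h' => hzw ((torusDiagGraph L).adj_symm h')),
          add_zero]
    simp only [hsplit, sum_add_distrib]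
    rw [sum_comm (f := fun z w => if (torusDiagGraph L).Adj w z then hOut q ρ w z else 0), two_mul]
  -- (3)–(5) per site, count, lattice sums
  rw [hsum]
  calc 2 * ∑ z : TorusSite 2 L, ∑ w : TorusSite 2 L,
        (if (torusDiagGraph L).Adj z w then hOut q ρ z w else 0)
      ≤ 2 * ∑ z : TorusSite 2 L, gMaj q ρ (cabs (z 0)) (cabs (z 1)) := by
        gcongr with z
        exact (sum_adj_hOut_le q ρ z).trans (four_hOut_le_gMaj q hq ρ z)
    _ ≤ 2 * (q ^ 2 * (2 * Real.pi * (harmonic ρ : ℝ) + 8) +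
          (2 * q ^ 2 + 25 * q ^ 4 * Real.exp (2 * q ^ 2)) * 68 +
          (q ^ 2 / 2 + q ^ 4 * Real.exp (2 * q ^ 2))) := by
        gcongr
        exact (sum_gMaj_le q ρ).trans (sum_weighted_gMaj_le q ρ)
    _ = 4 * Real.pi * q ^ 2 * (harmonic ρ : ℝ) + 289 * q ^ 2 +
          3402 * q ^ 4 * Real.exp (2 * q ^ 2) := by ring


/-- **Diagonal energy of the Euclidean logarithmic monopole centred at `y`.** Translation of
`euclidLogMonopole_diagEnergy_le_origin`. Koma–Tasaki, PRL 68 (1992) 3248, proof of eq. (13),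
P2, note 9. [cite: KomaTasakiPRL1992, proof of eq. (13) (P2) and note 9] -/
theorem euclidLogMonopole_diagEnergy_le (L : ℕ) [NeZero L] (y : TorusSite 2 L) (q : ℝ)
    (hq : 0 ≤ q) (ρ : ℕ) :
    ∑ u : TorusSite 2 L, ∑ v : TorusSite 2 L,
        (if (torusDiagGraph L).Adj u v then
          (Real.cosh (q * euclidLogProfile (ρ ^ 2) (torusNormSq (u - y)) -
              q * euclidLogProfile (ρ ^ 2) (torusNormSq (v - y))) - 1)
        else 0) ≤
      4 * Real.pi * q ^ 2 * (harmonic ρ : ℝ) + 289 * q ^ 2 +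
        3402 * q ^ 4 * Real.exp (2 * q ^ 2) := by
  classical
  have htrans : (∑ u : TorusSite 2 L, ∑ v : TorusSite 2 L,
      (if (torusDiagGraph L).Adj u v then
        (Real.cosh (q * euclidLogProfile (ρ ^ 2) (torusNormSq (u - y)) -
            q * euclidLogProfile (ρ ^ 2) (torusNormSq (v - y))) - 1)
      else 0)) =
      ∑ z : TorusSite 2 L, ∑ w : TorusSite 2 L,
        (if (torusDiagGraph L).Adj z w then
          (Real.cosh (q * euclidLogProfile (ρ ^ 2) (torusNormSq z) -
              q * euclidLogProfile (ρ ^ 2) (torusNormSq w)) - 1)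
        else 0) := by
    refine Fintype.sum_equiv (Equiv.subRight y) _ _ fun u => ?_
    refine Fintype.sum_equiv (Equiv.subRight y) _ _ fun v => ?_
    simp only [Equiv.subRight_apply, torusDiagGraph_adj_sub_right_iff]
  rw [htrans]
  exact euclidLogMonopole_diagEnergy_le_origin q hq ρ

/-! ### The dipole on both bond graphs -/

omit [NeZero L] in
/-- `‖z‖_∞² ≤ |z|₂²`. [folklore] -/
private theorem torusNorm_sq_le_torusNormSqD (z : TorusSite 2 L) : torusNorm z ^ 2 ≤ torusNormSq z := by
  rw [torusNorm_two_eq_max, torusNormSq]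
  rcases le_total (min (z 0).val (L - (z 0).val)) (min (z 1).val (L - (z 1).val)) with h | h
  · rw [max_eq_right h]; exact Nat.le_add_left _ _
  · rw [max_eq_left h]; exact Nat.le_add_right _ _

/-- **Bondwise splitting of the dipole energy on disjoint supports**, for any bond graph whose
bonds have `ℓ^∞`-length `≤ 1`: with `2ρ + 1 ≤ dist(x,y)` the monopoles about `y` and `x` vary
on disjoint sets of bonds, so `E_G(φ^{(y)} - φ^{(x)}) = E_G(φ^{(y)}) + E_G(φ^{(x)})`. [folklore] -/
private theorem dipole_energy_split (G : SimpleGraph (TorusSite 2 L)) [DecidableRel G.Adj]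
    (x y : TorusSite 2 L) (q : ℝ) (ρ : ℕ) (hρ1 : 1 ≤ ρ) (hρ : 2 * ρ + 1 ≤ torusDist x y)
    (hadj : ∀ u v, G.Adj u v → torusDist u y ≤ torusDist v y + 1 ∧ torusDist v y ≤ torusDist u y + 1) :
    ∑ u : TorusSite 2 L, ∑ v : TorusSite 2 L, (if G.Adj u v then
        (Real.cosh ((q * euclidLogProfile (ρ ^ 2) (torusNormSq (u - y)) -
              q * euclidLogProfile (ρ ^ 2) (torusNormSq (u - x))) -
            (q * euclidLogProfile (ρ ^ 2) (torusNormSq (v - y)) -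
              q * euclidLogProfile (ρ ^ 2) (torusNormSq (v - x)))) - 1) else 0) =
      (∑ u : TorusSite 2 L, ∑ v : TorusSite 2 L, (if G.Adj u v then
          (Real.cosh (q * euclidLogProfile (ρ ^ 2) (torusNormSq (u - y)) -
              q * euclidLogProfile (ρ ^ 2) (torusNormSq (v - y))) - 1) else 0)) +
        ∑ u : TorusSite 2 L, ∑ v : TorusSite 2 L, (if G.Adj u v then
          (Real.cosh (q * euclidLogProfile (ρ ^ 2) (torusNormSq (u - x)) -
              q * euclidLogProfile (ρ ^ 2) (torusNormSq (v - x))) - 1) else 0) := by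
  set A : TorusSite 2 L → ℝ := fun u => q * euclidLogProfile (ρ ^ 2) (torusNormSq (u - y))
    with hA
  set B : TorusSite 2 L → ℝ := fun u => q * euclidLogProfile (ρ ^ 2) (torusNormSq (u - x))
    with hB
  have hsat : ∀ u c : TorusSite 2 L, ρ ≤ torusDist u c →
      euclidLogProfile (ρ ^ 2) (torusNormSq (u - c)) = Real.log ρ := by
    intro u c huc
    have h2 : ρ ^ 2 ≤ torusNormSq (u - c) :=
      (Nat.pow_le_pow_left huc 2).trans (torusNorm_sq_le_torusNormSqD (u - c))
    rw [euclidLogProfile_of_geD _ _ h2, euclidLogProfile_sq_selfD ρ hρ1]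
  have hsplit : ∀ u v, G.Adj u v →
      Real.cosh ((A u - B u) - (A v - B v)) - 1 =
        (Real.cosh (A u - A v) - 1) + (Real.cosh (B u - B v) - 1) := by
    intro u v huv
    have hre : (A u - B u) - (A v - B v) = (A u - A v) - (B u - B v) := by ring
    rw [hre]
    by_cases hfar : ρ ≤ torusDist u y ∧ ρ ≤ torusDist v y
    · have hA0 : A u - A v = 0 := by
        simp only [hA, hsat u y hfar.1, hsat v y hfar.2, sub_self]
      rw [hA0, zero_sub, Real.cosh_neg, Real.cosh_zero, sub_self, zero_add]
    · have hd := hadj u v huv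
      have huy : torusDist u y ≤ ρ := by omega
      have hvy : torusDist v y ≤ ρ := by omega
      have htu := torusDist_triangle' x u y
      have htv := torusDist_triangle' x v y
      rw [torusDist_comm' x u] at htu
      rw [torusDist_comm' x v] at htv
      have hux : ρ ≤ torusDist u x := by omega
      have hvx : ρ ≤ torusDist v x := by omega
      have hB0 : B u - B v = 0 := by
        simp only [hB, hsat u x hux, hsat v x hvx, sub_self]
      rw [hB0, sub_zero, Real.cosh_zero, sub_self, add_zero]
  show ∑ u : TorusSite 2 L, ∑ v : TorusSite 2 L,
      (if G.Adj u v then (Real.cosh ((A u - B u) - (A v - B v)) - 1) else 0) =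
    (∑ u : TorusSite 2 L, ∑ v : TorusSite 2 L,
      (if G.Adj u v then (Real.cosh (A u - A v) - 1) else 0)) +
    ∑ u : TorusSite 2 L, ∑ v : TorusSite 2 L,
      (if G.Adj u v then (Real.cosh (B u - B v) - 1) else 0)
  rw [← sum_add_distrib]
  refine sum_congr rfl fun u _ => ?_
  rw [← sum_add_distrib]
  refine sum_congr rfl fun v _ => ?_
  split_ifs with huv
  · exact hsplit u v huv
  · simp

/-- **The Euclidean truncated logarithmic dipole on both bond graphs of the `t–t'` lattice.**
On `(ℤ/Lℤ)²`, for sites `x, y`, a charge `q ≥ 0` and a radius `ρ ≥ 1` with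
`2ρ + 1 ≤ dist_∞(x,y)`, the dipole `φ = φ^{(y)} - φ^{(x)}`, `φ^{(c)}(u) = q g_{ρ²}(|u - c|₂²)`, has
gain `φ_x - φ_y = 2q log ρ`, nearest-neighbour energy
`≤ 2 (2π q² H(ρ) + 76 q² + 544 q⁴ e^{2q²})` and next-nearest-neighbour (diagonal) energy
`≤ 2 (4π q² H(ρ) + 289 q² + 3402 q⁴ e^{2q²})`. Koma–Tasaki, PRL 68 (1992) 3248, proof of
eq. (13) (P1–P2) with note 9 (the bound extends to finite-range hopping, each bond family with
its own amplitude); explicit Euclidean-logarithm version with the sharp coefficients `2π`, `4π`.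
[cite: KomaTasakiPRL1992, proof of eq. (13) (P1–P2) and note 9] -/
theorem exists_euclidLogDipole_two_graphs (L : ℕ) [NeZero L] (x y : TorusSite 2 L) (q : ℝ)
    (hq : 0 ≤ q) (ρ : ℕ) (hρ1 : 1 ≤ ρ) (hρ : 2 * ρ + 1 ≤ torusDist x y) :
    ∃ φ : TorusSite 2 L → ℝ, φ x - φ y = 2 * q * Real.log ρ ∧
      (∑ u : TorusSite 2 L, ∑ v : TorusSite 2 L,
          (if (torusGraph 2 L).Adj u v then (Real.cosh (φ u - φ v) - 1) else 0) ≤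
        2 * (2 * Real.pi * q ^ 2 * (harmonic ρ : ℝ) + 76 * q ^ 2 +
          544 * q ^ 4 * Real.exp (2 * q ^ 2))) ∧
      (∑ u : TorusSite 2 L, ∑ v : TorusSite 2 L,
          (if (torusDiagGraph L).Adj u v then (Real.cosh (φ u - φ v) - 1) else 0) ≤
        2 * (4 * Real.pi * q ^ 2 * (harmonic ρ : ℝ) + 289 * q ^ 2 +
          3402 * q ^ 4 * Real.exp (2 * q ^ 2))) := by
  classical
  set A : TorusSite 2 L → ℝ := fun u => q * euclidLogProfile (ρ ^ 2) (torusNormSq (u - y))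
    with hA
  set B : TorusSite 2 L → ℝ := fun u => q * euclidLogProfile (ρ ^ 2) (torusNormSq (u - x))
    with hB
  have hsat : ∀ u c : TorusSite 2 L, ρ ≤ torusDist u c →
      euclidLogProfile (ρ ^ 2) (torusNormSq (u - c)) = Real.log ρ := by
    intro u c huc
    have h2 : ρ ^ 2 ≤ torusNormSq (u - c) :=
      (Nat.pow_le_pow_left huc 2).trans (torusNorm_sq_le_torusNormSqD (u - c))
    rw [euclidLogProfile_of_geD _ _ h2, euclidLogProfile_sq_selfD ρ hρ1]
  refine ⟨fun u => A u - B u, ?_, ?_, ?_⟩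
  · -- gain
    have hxy : ρ ≤ torusDist x y := by omega
    have hyx : ρ ≤ torusDist y x := by rw [torusDist_comm']; exact hxy
    have hAx : A x = q * Real.log ρ := by simp only [hA, hsat x y hxy]
    have hBy : B y = q * Real.log ρ := by simp only [hB, hsat y x hyx]
    have hAy : A y = 0 := by
      simp only [hA, sub_self]
      rw [show torusNormSq (0 : TorusSite 2 L) = 0 by simp [torusNormSq],
        euclidLogProfile_of_le_oneD _ _ zero_le_one, mul_zero]
    have hBx : B x = 0 := by
      simp only [hB, sub_self]
      rw [show torusNormSq (0 : TorusSite 2 L) = 0 by simp [torusNormSq],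
        euclidLogProfile_of_le_oneD _ _ zero_le_one, mul_zero]
    show (A x - B x) - (A y - B y) = 2 * q * Real.log ρ
    rw [hAx, hBy, hAy, hBx]
    ring
  · -- nearest-neighbour energy
    have hsplit := dipole_energy_split (torusGraph 2 L) x y q ρ hρ1 hρ
      (fun u v huv => torusDist_le_of_adj L huv y)
    have hmonoY := euclidLogMonopole_energy_le L y q hq ρ
    have hmonoX := euclidLogMonopole_energy_le L x q hq ρ
    simp only [hA, hB]
    rw [hsplit]
    linarith
  · -- diagonal energy
    have hdiag : ∀ u v : TorusSite 2 L, (torusDiagGraph L).Adj u v →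
        torusDist u y ≤ torusDist v y + 1 ∧ torusDist v y ≤ torusDist u y + 1 := by
      intro u v huv
      have h1 := torusDist_le_one_of_diagAdj huv
      have h2 := torusDist_triangle' u v y
      have h3 := torusDist_triangle' v u y
      rw [torusDist_comm' v u] at h3
      exact ⟨by omega, by omega⟩
    have hsplit := dipole_energy_split (torusDiagGraph L) x y q ρ hρ1 hρ hdiag
    have hmonoY := euclidLogMonopole_diagEnergy_le L y q hq ρ
    have hmonoX := euclidLogMonopole_diagEnergy_le L x q hq ρ
    simp only [hA, hB]
    rw [hsplit]
    linarith

end Literature.MathematicalPhysics.QuantumLattice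

end
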